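import Summits.HodgeConjecture.CorCM.HypDel.M1primeOfFUPart1   -- E-FU part 1
import Literature.AlgebraicGeometry.ModuliOfAbelianVarieties.SiegelModuliTower   -- ★ p686011 (B-p09 g7): W1b tower of record (`tr`, `tr_id`, `tr_comp`, `N_ne_zero`, `N_eq_mul_div` used from the tree)

/-!
# M1′ from (F) and (U) — E-FU PART 2 of 7 (+ HEAD `M1primeOfFU`): 
§ 2 — W1b CLOSER (B-p09 g7; B-p04 g13 support): the level tower over an arbitrary family of fine moduli schemes, `stubW1b`

Cell hodgecm-mathlib, rung 0 of the Mumford line under `HDel` (item `stmt-HodgeConjecture-24835`).  The E-FU text proves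
`deligne1971_siegelModuliOnPoints` (M1′ = [Deligne 1971, 4.16–4.21 on points]) as a THEOREM of the two finer printed facts
(F) `lan2013_siegelFineModuliScheme` [Lan 2013, Thm. 1.4.1.11 + Cor. 7.2.3.9] and (U) `siegelModuli_complexUniformisation`
[MFK94 App. 7A; Deligne 1971, 4.12–4.21; Milne 2005 Thm. 6.11]; it is split into a chain of part files only because of the
400-line cap on proof-bearing `Summits/` files (B-plan1 R22, director s96).  The composition and `theorem M1prime_of_F_U` live in
the HEAD file `Summits/HodgeConjecture/CorCM/HypDel/M1primeOfFU.lean`; provenance of every § is kept in its banner below and in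
HOME `B-plan/lines/m1prime/M1primeOfFU.skeleton.md`.  This part does NOT depend on (F)/(U).
HC_CM is proved only modulo the 7 printed citations until rung 0 closes.
-/

universe u   -- was declared inside the dropped D1 paste
open CategoryTheory CategoryTheory.Limits AlgebraicGeometry MonoidalCategory   -- was a TOP-LEVEL `open` of the dropped D1 paste (and of (M)); the pasted (F)/(U)/partC/§§ rely on it

/-! ## W2 (c1)–(c3): the LEVEL CHANGE `σ ↦ σ^d` of a level structure (B-p09 g7, W2 pen; B-plan1 P30 2026-08-28T23:41:11Z)
(closer-§ provenance and fold history: HOME `B-plan/lines/m1prime/M1primeOfFU.skeleton.md` + the by-import twin editions.) -/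

noncomputable section

namespace Literature.AlgebraicGeometry.AbelianSchemes

namespace AbelianSchemeOver

open CategoryTheory CategoryTheory.Limits AlgebraicGeometry MonoidalCategory
open scoped MonObj CategoryTheory.Obj

variable {S : Scheme.{u}} (A : AbelianSchemeOver S)

/-! ### Fibrewise exponent calculus in the commutative `X_s(Ω)` (TEMP: the two lemmas below belong to B-p11 (g10)'s
booked fibrewise family `SectionPowFibrewise` — replace by his ★ names on landing; kept `private` here) -/

section Fibrewise

variable {Ω : Type u} [Field Ω] (s : Spec (.of Ω) ⟶ S)

/-- `σ^a(s) = ∏ₖ pₖ^{aₖ}` as a `Finset` product in the COMMUTATIVE group `X_s(Ω) = (A.fibre s).toAbelianVariety(Ω)`, for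
any family `p` of points of that group agreeing with the `σₖ(s)` ((O4) `restrictPt_sectionPow` + `List.prod_ofFn` +
`Fintype.prod_sum_type`; the family `p` carries the commutative-group typing). [folklore] -/
private theorem restrictPt_sectionPow_eq_finsetProd {g n : ℕ} (σ : Fin g ⊕ Fin g → A.Sections)
    (a : Fin g ⊕ Fin g → ZMod n) (p : Fin g ⊕ Fin g → (A.fibre s).toAbelianVariety.Points Ω)
    (hp : ∀ k, A.restrictPt s (σ k) = p k) :
    A.restrictPt s (A.sectionPow σ a) = ∏ k, p k ^ (a k).val := by
  have h := A.restrictPt_sectionPow s σ a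
  simp only [hp] at h
  rw [Fintype.prod_sum_type, ← List.prod_ofFn, ← List.prod_ofFn]
  exact h

/-- **Exponent calculus in a commutative group**: for `pₖ^n = 1` and exponent vectors with `b'ₖ ≡ m·bₖ (mod n)`,
`∏ pₖ^{b'ₖ} = (∏ pₖ^{bₖ})^m` — the homomorphism property of `b ↦ σ^b(s)` (MFK Def. 7.1 «`Σ aᵢσᵢ(s)`»). [folklore] -/
private theorem finsetProd_pow_val_eq_pow {g n : ℕ} {G : Type*} [CommMonoid G] (p : Fin g ⊕ Fin g → G)
    (hp : ∀ k, p k ^ n = 1) (b b' : Fin g ⊕ Fin g → ZMod n) (m : ℕ)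
    (hb' : ∀ k, (b' k).val = (m * (b k).val) % n) :
    ∏ k, p k ^ (b' k).val = (∏ k, p k ^ (b k).val) ^ m := by
  rw [← Finset.prod_pow]
  refine Finset.prod_congr rfl fun k _ => ?_
  rw [← pow_mul, hb', ← pow_eq_pow_mod _ (hp k), Nat.mul_comm m]

end Fibrewise

namespace LevelStructure

variable {A} {g N : ℕ} (φ : A.LevelStructure g N)

end LevelStructure

end AbelianSchemeOver

end Literature.AlgebraicGeometry.AbelianSchemes

end

/- § 2 — W2 (c5) `SymplecticLift.changeLevel` block (B-p09 g7; 10 decls) RE-POINTED BY IMPORT to ★ p683953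
`Literature.AlgebraicGeometry.AbelianSchemes.SymplecticLiftChangeLevel` (same FQNs token-for-token; B-plan1 (g9) R16 (c) DEDUP FINDING
`B-plan/B-plan1g9/dedup/FINDING.md`, PoC 1fda4f5eb2ba0c78) — twin v12, B-plan2 g8. -/

/- § 2 — W2 `PolarizedAbelianSchemeWithLevel.changeLevel` block (B-p09 g7; 5 decls) RE-POINTED BY IMPORT to ★ p685099
`Literature.AlgebraicGeometry.AbelianSchemes.PolarizedLevelChange` (same FQNs; R16 (c)) — twin v12, B-plan2 g8. -/

/-! ## W1b (B-p09 g7): the TOWER over an ARBITRARY family of fine moduli schemes, in MARKING currency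
((P)-skeleton v0.3 cut, B-plan2 2026-08-29T00:09:13Z (2): «StubW1b (pen B-p09): ∀ family 𝓜• — ∃ tr, tr_id, tr_comp,
ℂ-side (F-c′) from a ℚ-side hypothesis, and tr_marked: MarkedBy_K J a P′ → ∃ P″, MarkedBy_{K′} J a P″ ∧ cm_K P′ ≫ tr f =
cm_{K′} P″»).  HOME-only BY PASTE over the (P)-skeleton v0.2 7172336568d4e5e6 ll. 1–2449 (carriers + (F) + (U) + §R incl.
(closer-§ provenance and fold history: HOME `B-plan/lines/m1prime/M1primeOfFU.skeleton.md` + the by-import twin editions.) -/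

noncomputable section

namespace Summit.HodgeConjecture.CorCM.HypDel.M1primeOfFU

open CategoryTheory CategoryTheory.Limits AlgebraicGeometry
open Literature.AlgebraicGeometry
open Literature.AlgebraicGeometry.Motives (SchemeOver ComplexPoints AlgPoints specOver AbelianVariety CartierDivisor)
open Literature.AlgebraicGeometry.AbelianSchemes (PolarizedAbelianSchemeWithLevel)
open Literature.AlgebraicGeometry.AbelianSchemes.AbelianSchemeOver (LevelStructure)
open Literature.AlgebraicGeometry.HodgeTheory (IsQuasiProjectiveOver)
open Literature.AlgebraicGeometry.ModuliOfAbelianVarieties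

namespace W1b

variable {g : ℕ} {δ : Fin g → ℕ}

-- W1b tower of record = ★ `SiegelModuliTower` (B-p09 g7, p686011): `tr`, its functor laws and the level arithmetic are
-- USED FROM THE TREE (gate `dedup.landed` on the former local copies, Part 2 dry-run 2026-08-29T02:59Z); only the
-- marking-currency statements `MarkedBy.changeLevel`, `classifyingMap_comp_of_isBaseChangeVia`, `tr_marked`, `stubW1b` live here.
open Literature.AlgebraicGeometry.ModuliOfAbelianVarieties.SiegelModuliTower (tr tr_id tr_comp N_ne_zero N_eq_mul_div)

/-! ### (c6) The level change of a marked triple is marked (same `(J, a)`) -/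

/-- **(c6) `MarkedBy` IS STABLE UNDER THE LEVEL CHANGE**: if `P′` (level `N`) over `Spec ℂ` is marked by `(J, a)`, so is
`P′.changeLevel N′ d` (`N = N′ d`) — with the SAME marking `m` and witness `Θ` and the re-indexed lift `Λ.changeLevel`:
its tower at `N′ ∣ M` is `lift_{dM} ∘ (d • ·)`, and `a⁻¹ v ≡ x/M` is literally `a⁻¹ v ≡ (d x̃)/(dM)` in `ℚ^{2g}`
(Milne's `η_a` at level `N′` is `η_a` at level `N` composed with `[d]`, [Milne2005ShimuraVarieties] (63) / §5 p. 55).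
[cite: Milne2005ShimuraVarieties, §6 Thm. 6.11 p. 74 and §5 p. 55] [cite: Deligne1971TravauxShimura, 4.12 (b) p. 149, 1.8 p. 129] -/
theorem MarkedBy.changeLevel {N : ℕ} {J : C0pm δ} {a : gspFinAdelic δ}
    {P' : PolarizedAbelianSchemeWithLevel g N δ (specOver ℚ ℂ).left} (h : MarkedBy J a P') (N' d : ℕ)
    (hd : N = N' * d) (hN : N ≠ 0) : MarkedBy J a (P'.changeLevel N' d hd hN) := by
  obtain ⟨m, Θ, Λ, hΘ, hlam, hΛ⟩ := h
  have hd0 : d ≠ 0 := by rintro rfl; exact hN (by rw [hd, mul_zero])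
  refine ⟨m, Θ, Λ.changeLevel N' d hd hN, hΘ, hlam, ?_⟩
  intro M hM hM0 x v hv
  haveI : NeZero M := ⟨hM0⟩
  have hNdM : N ∣ d * M := by rw [hd, mul_comm N' d]; exact Nat.mul_dvd_mul_left d hM
  rw [Λ.changeLevel_lift N' d hd hN hd0]
  refine (Λ.coe_liftPow_ofAdd_eq_lift_nsmul d hd0 hM0 x).trans
    (hΛ hNdM (Nat.mul_ne_zero hd0 hM0) (d • fun k => ((x k).val : ZMod (d * M))) v ?_)
  have hvec : (fun i => ((((d • fun k => ((x k).val : ZMod (d * M))) i).val : ℚ) / ((d * M : ℕ) : ℚ))) =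
      fun i => ((x i).val : ℚ) / M := by
    funext i
    rw [Pi.smul_apply, nsmul_eq_mul, ← Nat.cast_mul, ZMod.val_natCast,
      Nat.mod_eq_of_lt (Nat.mul_lt_mul_of_pos_left (ZMod.val_lt _) (Nat.pos_of_ne_zero hd0)), Nat.cast_mul,
      Nat.cast_mul, mul_div_mul_left _ _ (Nat.cast_ne_zero.2 hd0)]
  rw [hvec]
  exact hv

/-! ### The tower over a family `𝓜 : ∀ K, SiegelFineModuliScheme g K.N δ` -/

/-- **Classifying morphisms compose with pull-backs** (MFK Def. 7.3 naturality in relation form; = B-typ01's (M) v5/v6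
`classifyingMap_comp`, restated locally so this § elaborates over any (M) edition). [cite: MumfordFogartyKirwan1994, Ch. 7 §2 Definition 7.3 (p. 130)] -/
theorem classifyingMap_comp_of_isBaseChangeVia {N : ℕ} (𝓝 : SiegelFineModuliScheme g N δ) {T T' : SchemeOver ℚ}
    [IsLocallyNoetherian T.left] [IsLocallyNoetherian T'.left] (x : T' ⟶ T)
    (P' : PolarizedAbelianSchemeWithLevel g N δ T.left) (Pₓ : PolarizedAbelianSchemeWithLevel g N δ T'.left)
    {G : Pₓ.A.X.left ⟶ P'.A.X.left} {Ĝ : Pₓ.D.hat.X.left ⟶ P'.D.hat.X.left}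
    (hx : Pₓ.IsBaseChangeVia P' x.left G Ĝ) :
    x ≫ 𝓝.classifyingMap T P' = 𝓝.classifyingMap T' Pₓ := by
  obtain ⟨G₀, Ĝ₀, h₀⟩ := 𝓝.exists_isBaseChangeVia_classifyingMap T P'
  exact 𝓝.eq_classifyingMap T' Pₓ (x ≫ 𝓝.classifyingMap T P') ⟨G ≫ G₀, Ĝ ≫ Ĝ₀, hx.trans h₀⟩

/-- **`tr_marked` — THE TRANSITIONS IN MARKING CURRENCY**: for a `(J, a)`-marked triple `P′` of level `N(K)` over
`Spec ℂ` there is a `(J, a)`-marked triple `P″` of level `N(K′)` (namely its level change) whose classifying point is the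
image of that of `P′` under `tr f` — (c6) + the naturality (n1)+(c4).  With the J1 dictionary at `K` and `K′` this IS the
record field `map_pts` («`[J, aK] ↦ [J, aK′]`»). [cite: Milne2005ShimuraVarieties, §5 p. 55 and §6 Thm. 6.11 p. 74]
[cite: Deligne1971TravauxShimura, 1.8 p. 129, 4.16 p. 150] -/
theorem tr_marked (hg : 0 < g) (𝓜 : ∀ K : SiegelLevel δ, SiegelFineModuliScheme g K.N δ) {K K' : SiegelLevel δ} (f : K ⟶ K')
    (J : C0pm δ) (a : gspFinAdelic δ)
    (P' : PolarizedAbelianSchemeWithLevel g K.N δ (specOver ℚ ℂ).left) (hP' : MarkedBy J a P') :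
    haveI : IsLocallyNoetherian (specOver ℚ ℂ).left :=
      inferInstanceAs (IsLocallyNoetherian (Spec (CommRingCat.of ℂ)))
    ∃ P'' : PolarizedAbelianSchemeWithLevel g K'.N δ (specOver ℚ ℂ).left, MarkedBy J a P'' ∧
      (𝓜 K).classifyingMap (specOver ℚ ℂ) P' ≫ tr hg 𝓜 f = (𝓜 K').classifyingMap (specOver ℚ ℂ) P'' := by
  haveI : IsLocallyNoetherian (specOver ℚ ℂ).left := inferInstanceAs (IsLocallyNoetherian (Spec (CommRingCat.of ℂ)))
  haveI := (𝓜 K).isLocallyNoetherian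
  refine ⟨P'.changeLevel K'.N (K.N / K'.N) (N_eq_mul_div hg f) (N_ne_zero K),
    MarkedBy.changeLevel hP' K'.N (K.N / K'.N) (N_eq_mul_div hg f) (N_ne_zero K), ?_⟩
  obtain ⟨G, Ĝ, h⟩ := (𝓜 K).exists_isBaseChangeVia_classifyingMap (specOver ℚ ℂ) P'
  exact classifyingMap_comp_of_isBaseChangeVia (𝓜 K') _ _ _
    (h.changeLevel K'.N (K.N / K'.N) (N_eq_mul_div hg f) (N_ne_zero K))

/-- **`StubW1b` ((P)-skeleton v0.3 4a8da763 :2421, pen B-p09) — PROVED**, for EVERY family `𝓜` (no (F)/(U) needed):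
`tr := SiegelModuliTower.tr` (★ `SiegelModuliTower`, B-p09), its laws `tr_id`/`tr_comp` from the tree, and `tr_marked` (here). [cite: Deligne1971TravauxShimura, 1.8 p. 129, 4.16–4.17 p. 150]
[cite: MumfordFogartyKirwan1994, App. 7A (pp. 235–236)] [cite: Milne2005ShimuraVarieties, §5 p. 56] -/
theorem stubW1b : (∀ (g : ℕ) (δ : Fin g → ℕ), StubW1b g δ) :=
  fun _g _δ hg _hδ 𝓜 =>
    ⟨fun _ _ f => tr hg 𝓜 f, tr_id hg 𝓜, fun _ _ _ f f' => tr_comp hg 𝓜 f f',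
      fun _ _ f J a P' hP' => tr_marked hg 𝓜 f J a P' hP'⟩

end W1b

end Summit.HodgeConjecture.CorCM.HypDel.M1primeOfFU

end
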